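import Summits.SmoothPoincare4.SmoothPoincare4.Theses.WeakReductionDescent
import Summits.SmoothPoincare4.SmoothPoincare4.Theorems.WeakReductionDescentMinimalWeaklyReducibleOfRungs
import Literature.Topology.FourManifolds.CircleSurgery
import Literature.Topology.FourManifolds.SphereTrisectionsSectors
import Literature.Topology.FourManifolds.TrisectionFunctorGKNaturality
import Literature.Topology.FourManifolds.TrisectionSectorCollars
import Literature.Topology.FourManifolds.HomotopyS4OrientableProofs

/-!
# Helper `helper_loopNoDescentFromFive_rungFive` of stub `stub_loopNoDescentFromFive` (L₅)
(line `loop_dichotomy`, crux `WeakReductionDescent.WeakReductionReduces` = stmt-SmoothPoincare4-17908)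

The registered stub L₅ says: a smooth homotopy 4-sphere `M` whose MINIMAL Gay–Kirby trisection
genus is `g ≥ 5` is not a circle surgery `X_ℓ` (`IsCircleSurgery (𝓡 4) (𝓡 4) X M ℓ`) on any
smooth `X` carrying a GK-trisection of genus `g' < g`.  It is SPC4-implied (under SPC4 no
minimal genus `≥ 1` occurs) and open.  This file records, kernel-checked, the **rung-`5`
reduction** of L₅ to three literature facts and ONE typed residual hypothesis, all four taken as
HYPOTHESES spelled out inline (so the registered signature names no new constant; the three facts
are vendored as named `def … : Prop` in the sibling file `…StubLoopNoDescentFromFiveAux2.lean`):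

* (F0) orientability passes from `P = X_ℓ` back to `X` (`X ∖ ℓ` embeds openly in `P`; the tube
  `S¹ × ℝ³` is orientable and meets it in a connected set) [Hirsch, *Differential Topology*, §4.4];
* (F1) Meier–Schirmer–Zupan 2016 Thm. 1.2 (arXiv:1507.06561 numbering) for loop presentations of
  homotopy spheres: if a closed connected oriented `X` has a `(g; k)`-GK-trisection with some
  `kᵢ ≥ g - 1` and a surgery on a smoothly embedded loop `ℓ ⊂ X` is a homotopy 4-sphere `M`, then
  `M ≅ S⁴` (`X` is standard; `χ(X) = 0` leaves `X ≅ S¹ × S³`; `[ℓ] = ±1`; `S_{±1} ≅ S'_{±1} ≅ S⁴`,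
  Pao 1977 / Aranda–Zupan 2025 p. 7 — the last step PROVED in the tree,
  `isCircleSurgery_sphereOne_prod_sphereThree_sphereFour`);
* (F2) the `χ`-free Euler-characteristic bookkeeping: in the same situation `k₀ + k₁ + k₂ = g + 2`
  (`χ(X) = 2 + g - Σ kᵢ`, Gay–Kirby Remark 2; `χ(X_ℓ) = χ(X) + 2`, Gompf–Stipsicz §5.2;
  `χ(M) = 2`);
* (H₄₂₂₂ — the honest open RESIDUE of L₅ at rung `5`, not a literature fact) no smooth orientable
  `X` with a `(4; 2, 2, 2)`-GK-trisection presents, by surgery on a smoothly embedded loop, a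
  smooth homotopy 4-sphere having a genus-`5` GK-trisection and none of smaller genus.

`helper_loopNoDescentFromFive_rungFive : F0 → F1 → F2 → H₄₂₂₂ → (L₅ with 5 ≤ g ≤ 5)`.
Proof: given the loop presentation `M = X_ℓ` with `IsGKTrisection X g' k' T'`, `g' < 5`, `X` is
compact and connected (trisected; PROVED tree lemmas) and orientable (F0, `M` being orientable as
a homotopy sphere — Lee 2013 Thm. 15.43, PROVED in the tree:
`isOrientable_of_homotopyEquiv_sphere_four_holds`); F2 gives `Σ k' = g' + 2`; if some
`k'ᵢ + 1 ≥ g'` then F1 gives `M ≅ S⁴`, and Gay–Kirby's genus-`0` trisection of the round sphere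
pulled back along the diffeomorphism contradicts minimality (landed lemma
`not_minimalGenus_of_diffeomorph_sphere`); otherwise `g' = 4` and `k' = (2, 2, 2)` by
arithmetic (`typeArith_loopPartner_rungFive`), which is H₄₂₂₂'s case.  The partners of genus
`g' ≤ 3` are thus disposed of by F1/F2 alone (no use of the neighbouring stub
`stub_loopFromGenusThree`).  No definitions, no named facts, no `sorry`.
-/

-- the registered namespace `Summit.SmoothPoincare4.SmoothPoincare4.…` repeats a component
set_option linter.dupNamespace false

open scoped Manifold ContDiff ContinuousMap Topology
open Set
open Literature.Topology.FourManifolds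

namespace Summit.SmoothPoincare4.SmoothPoincare4.Theorems.WeakReductionReduces.LoopDichotomy

/-- A GK-trisected manifold is connected: the three sectors are path connected (continuous
images of connected handlebodies) and share the (nonempty) central surface. [cite: GayKirby2016, Def. 1] -/
theorem connectedSpace_of_isGKTrisection {X : Type} [TopologicalSpace X] [T2Space X]
    [ChartedSpace (EuclideanSpace ℝ (Fin 4)) X]
    {g : ℕ} {k : Fin 3 → ℕ} {S : Fin 3 → Set X} (h : IsGKTrisection X g k S) :
    ConnectedSpace X := by
  obtain ⟨x, hx⟩ := h.nonempty_iInter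
  have hx' := Set.mem_iInter.1 hx
  have h012 : IsPathConnected ((S 0 ∪ S 1) ∪ S 2) :=
    (h.isPathConnected_union 0 1).union (h.isPathConnected_sector 2) ⟨x, Or.inl (hx' 0), hx' 2⟩
  have huniv : (S 0 ∪ S 1) ∪ S 2 = Set.univ := by
    apply Set.eq_univ_of_forall
    intro y
    obtain ⟨i, hi⟩ := h.exists_mem y
    fin_cases i
    · exact Or.inl (Or.inl hi)
    · exact Or.inl (Or.inr hi)
    · exact Or.inr hi
  rw [huniv] at h012
  haveI : PathConnectedSpace X := pathConnectedSpace_iff_univ.2 h012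
  infer_instance

/-- Type arithmetic of a loop partner at rung `5`: a `(g'; a, b, c)`-trisection with `g' ≤ 4`
and `a + b + c = g' + 2` (`χ = 0`) lies in the Meier–Schirmer–Zupan range (some entry
`≥ g' - 1`) unless it is of the single type `(4; 2, 2, 2)`. [folklore] -/
theorem typeArith_loopPartner_rungFive (g a b c : ℕ) (hg : g ≤ 4) (hχ : a + b + c = g + 2) :
    (g ≤ a + 1 ∨ g ≤ b + 1 ∨ g ≤ c + 1) ∨ (g = 4 ∧ a = 2 ∧ b = 2 ∧ c = 2) := by
  omega

/-- **Rung `5` of L₅ reduces to the single loop-partner type `(4; 2, 2, 2)`.**  Hypotheses, in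
order: (F0) orientability passes from `X_ℓ` to `X` [Hirsch §4.4]; (F1) Meier–Schirmer–Zupan 2016
Thm. 1.2 for loop presentations of homotopy spheres (`kᵢ ≥ g - 1` for some `i` and
`X_ℓ ≃ₕ S⁴` ⇒ `X_ℓ ≅ S⁴`); (F2) `Σ kᵢ = g + 2` for a trisected loop partner of a homotopy sphere
(`χ(X) = 0`, Gay–Kirby Remark 2 with `χ(X_ℓ) = χ(X) + 2`); and (H₄₂₂₂) the RESIDUAL
HYPOTHESIS — NOT a literature fact, the honest open residue of the stub at rung `5`: no smooth
orientable `X` with a `(4; 2, 2, 2)`-GK-trisection presents, by surgery on a smoothly embedded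
loop, a smooth homotopy 4-sphere that has a genus-`5` GK-trisection and none of smaller genus.
Conclusion: the registered stub `stub_loopNoDescentFromFive` at `g = 5` (its signature verbatim
with `g ≤ 5` added).  Proof: for `M = X_ℓ` with `X` `(g'; k')`-trisected, `g' < 5`, `X` is
compact, connected (trisected) and orientable (F0; `M` is orientable as a homotopy sphere,
Lee 2013 Thm. 15.43, PROVED in the tree), F2 gives `Σ k' = g' + 2`, so either some
`k'ᵢ + 1 ≥ g'` and F1 makes `M ≅ S⁴`, whose genus-`0` trisection contradicts minimality, or
`(g'; k') = (4; 2, 2, 2)` (`typeArith_loopPartner_rungFive`) and H₄₂₂₂ applies.  Conditional on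
its four hypotheses only (no named fact is consumed).
[cite: MeierSchirmerZupan2016, Thm. 1.2 (arXiv numbering)] [cite: GayKirby2016, Remark 2]
[cite: HirschDT1976, §4.4] -/
theorem helper_loopNoDescentFromFive_rungFive : (∀ (X : Type) [TopologicalSpace X] [T2Space X] [SecondCountableTopology X] [ChartedSpace (EuclideanSpace ℝ (Fin 4)) X] [IsManifold (𝓡 4) ∞ X] (ℓ : (Metric.sphere (0 : EuclideanSpace ℝ (Fin 2)) 1) → X) (P : Type) [TopologicalSpace P] [T2Space P] [SecondCountableTopology P] [ChartedSpace (EuclideanSpace ℝ (Fin 4)) P] [IsManifold (𝓡 4) ∞ P], Literature.Topology.FourManifolds.IsCircleSurgery (𝓡 4) (𝓡 4) X P ℓ → Literature.Topology.FourManifolds.IsOrientable (𝓡 4) P → Literature.Topology.FourManifolds.IsOrientable (𝓡 4) X) → (∀ (X : Type) [TopologicalSpace X] [T2Space X] [SecondCountableTopology X] [ChartedSpace (EuclideanSpace ℝ (Fin 4)) X] [IsManifold (𝓡 4) ∞ X] [CompactSpace X] [ConnectedSpace X], Literature.Topology.FourManifolds.IsOrientable (𝓡 4) X → ∀ (g :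 ℕ) (k : Fin 3 → ℕ) (S : Fin 3 → Set X), Literature.Topology.FourManifolds.IsGKTrisection X g k S → (∃ i, g ≤ k i + 1) → ∀ (ℓ : (Metric.sphere (0 : EuclideanSpace ℝ (Fin 2)) 1) → X), Manifold.IsSmoothEmbedding (𝓡 1) (𝓡 4) ∞ ℓ → ∀ (M : Type) [TopologicalSpace M] [T2Space M] [SecondCountableTopology M] [ChartedSpace (EuclideanSpace ℝ (Fin 4)) M] [IsManifold (𝓡 4) ∞ M], (M ≃ₕ (Metric.sphere (0 : EuclideanSpace ℝ (Fin 5)) 1)) → Literature.Topology.FourManifolds.IsCircleSurgery (𝓡 4) (𝓡 4) X M ℓ → Nonempty (Diffeomorph (𝓡 4) (𝓡 4) M (Metric.sphere (0 : EuclideanSpace ℝ (Fin 5)) 1) ∞)) → (∀ (X : Type) [TopologicalSpace X] [T2Space X] [SecondCountableTopology X] [ChartedSpace (EuclideanSpace ℝ (Fin 4)) X] [IsManifold (𝓡 4) ∞ X] [CompactSpace X] [ConnectedSpace X], Literature.Topology.FourManifolds.IsOrientable (𝓡 4) X → ∀ (g : ℕ) (k : Fin 3 → ℕ) (S : Fin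 3 → Set X), Literature.Topology.FourManifolds.IsGKTrisection X g k S → ∀ (ℓ : (Metric.sphere (0 : EuclideanSpace ℝ (Fin 2)) 1) → X), Manifold.IsSmoothEmbedding (𝓡 1) (𝓡 4) ∞ ℓ → ∀ (M : Type) [TopologicalSpace M] [T2Space M] [SecondCountableTopology M] [ChartedSpace (EuclideanSpace ℝ (Fin 4)) M] [IsManifold (𝓡 4) ∞ M], (M ≃ₕ (Metric.sphere (0 : EuclideanSpace ℝ (Fin 5)) 1)) → Literature.Topology.FourManifolds.IsCircleSurgery (𝓡 4) (𝓡 4) X M ℓ → k 0 + k 1 + k 2 = g + 2) → (∀ (M : Type) [TopologicalSpace M] [T2Space M] [SecondCountableTopology M] [ChartedSpace (EuclideanSpace ℝ (Fin 4)) M] [IsManifold (𝓡 4) ∞ M], (M ≃ₕ (Metric.sphere (0 : EuclideanSpace ℝ (Fin 5)) 1)) → ∀ (k : Fin 3 → ℕ) (T : Fin 3 → Set M), Literature.Topology.FourManifolds.IsGKTrisection M 5 k T → (∀ (g'' : ℕ) (k'' : Fin 3 → ℕ) (T'' : Fin 3 → Set M), Literature.Topology.FourManifolds.IsGKTrisection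 M g'' k'' T'' → 5 ≤ g'') → ∀ (X : Type) [TopologicalSpace X] [T2Space X] [SecondCountableTopology X] [ChartedSpace (EuclideanSpace ℝ (Fin 4)) X] [IsManifold (𝓡 4) ∞ X], Literature.Topology.FourManifolds.IsOrientable (𝓡 4) X → ∀ (T' : Fin 3 → Set X), Literature.Topology.FourManifolds.IsGKTrisection X 4 (fun _ => 2) T' → ∀ (ℓ : (Metric.sphere (0 : EuclideanSpace ℝ (Fin 2)) 1) → X), Manifold.IsSmoothEmbedding (𝓡 1) (𝓡 4) ∞ ℓ → ¬ Literature.Topology.FourManifolds.IsCircleSurgery (𝓡 4) (𝓡 4) X M ℓ) → ∀ (M : Type) [TopologicalSpace M] [T2Space M] [SecondCountableTopology M] [ChartedSpace (EuclideanSpace ℝ (Fin 4)) M] [IsManifold (𝓡 4) ∞ M], (M ≃ₕ (Metric.sphere (0 : EuclideanSpace ℝ (Fin 5)) 1)) → ∀ (g : ℕ) (k : Fin 3 → ℕ) (T : Fin 3 → Set M), Literature.Topology.FourManifolds.IsGKTrisection M g k T → 5 ≤ g → g ≤ 5 → (∀ (g'' : ℕ) (k'' : Fin 3 → ℕ) (T''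 : Fin 3 → Set M), Literature.Topology.FourManifolds.IsGKTrisection M g'' k'' T'' → g ≤ g'') → ∀ (X : Type) [TopologicalSpace X] [T2Space X] [SecondCountableTopology X] [ChartedSpace (EuclideanSpace ℝ (Fin 4)) X] [IsManifold (𝓡 4) ∞ X] (g' : ℕ) (k' : Fin 3 → ℕ) (T' : Fin 3 → Set X), g' < g → Literature.Topology.FourManifolds.IsGKTrisection X g' k' T' → ∀ (ℓ : (Metric.sphere (0 : EuclideanSpace ℝ (Fin 2)) 1) → X), Manifold.IsSmoothEmbedding (𝓡 1) (𝓡 4) ∞ ℓ → ¬ Literature.Topology.FourManifolds.IsCircleSurgery (𝓡 4) (𝓡 4) X M ℓ := by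
  intro hF0 hF1 hF2 hRes M _ _ _ _ _ e g k T hT hg5 hg5' hmin X _ _ _ _ _ g' k' T' hlt hT' ℓ hℓ hsurg
  obtain rfl : g = 5 := le_antisymm hg5' hg5
  -- the loop partner `X` is closed, connected, oriented
  haveI : CompactSpace X := hT'.compactSpace
  haveI : ConnectedSpace X := connectedSpace_of_isGKTrisection hT'
  have hMo : IsOrientable (𝓡 4) M := isOrientable_of_homotopyEquiv_sphere_four_holds M e
  have hXo : IsOrientable (𝓡 4) X := hF0 X ℓ M hsurg hMo
  -- `χ(X) = 0`, i.e. `Σ k' = g' + 2`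
  have hχ : k' 0 + k' 1 + k' 2 = g' + 2 := hF2 X hXo g' k' T' hT' ℓ hℓ M e hsurg
  rcases typeArith_loopPartner_rungFive g' (k' 0) (k' 1) (k' 2) (by omega) hχ with hMSZ | h4222
  · -- Meier–Schirmer–Zupan range: `M ≅ S⁴`, contradicting minimality
    have hex : ∃ i, g' ≤ k' i + 1 := by
      rcases hMSZ with h0 | h1 | h2
      · exact ⟨0, h0⟩
      · exact ⟨1, h1⟩
      · exact ⟨2, h2⟩
    obtain ⟨Φ⟩ := hF1 X hXo g' k' T' hT' hex ℓ hℓ M e hsurg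
    exact Summit.SmoothPoincare4.SmoothPoincare4.Theorems.not_minimalGenus_of_diffeomorph_sphere Φ
      (by norm_num) hmin
  · -- the residual type `(4; 2, 2, 2)`
    obtain ⟨rfl, h0, h1, h2⟩ := h4222
    have hk' : k' = fun _ => 2 := by
      funext i
      fin_cases i
      · exact h0
      · exact h1
      · exact h2
    subst hk'
    exact hRes M e k T hT hmin X hXo T' hT' ℓ hℓ hsurg

end Summit.SmoothPoincare4.SmoothPoincare4.Theorems.WeakReductionReduces.LoopDichotomy
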